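import Summits.Ventures.Crystal3D.Theorems.StickyWulffConstantCoaxialWallLawReadingDirections
import Summits.Ventures.Crystal3D.Theorems.StickyWulffConstantCoaxialWallLawTwinReaderRigidity
import HarnessLib

/-!
# Reader triangles: every reader of an end move reads a SLOT TRIANGLE; readers of reading directions have standard frames
# (crux `CoaxialWallLaw`, stmt-Ventures-19481, line `WallLedgerF`; T4 brick, census-free)

HONEST FRAMING. Venture `Summits/Ventures/Crystal3D` (cell `crystal3d-full`); helper `--supports` the crux `CoaxialWallLaw`
(stmt-Ventures-19481, `route-Ventures-StickyWulffConstant`), REGISTERED line `WallLedgerF` (planner cf-p1, (xcv)(1): T4 pieces first).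
Census-free; F-C1 not moved.  Links the reader predicates of `…EndRowDefs` to the generalized frame lemma of `…ReadingDirections`:
* `upper_cap_triangle_tab` (`decide`), `exists_upper_slot_triangle` — the three slots above a menu plane form a slot triangle;
* `exists_contact_triangle_of_isFull / _of_isTwinReading / _of_isNarrow / _of_isEndMove` — a FULL, TWIN or NARROW reader `q`
  (in particular the reader of any end move `IsEndMove X v G d q b`) has three OCCUPIED `G`-slots `q + G uᵢ` forming a slot triangle;
* **`stdFrame_of_isEndMove_of_readingDirs`** — if moreover every contact direction of `q` is a reading direction (`x − q ∈ readingDirs`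
  for all `x ∈ X` at distance `1`), then `G` is a standard placement (`StdFrame G`).  With `…ReadingDirectionsApex/Contacts`
  (module bonds and host-to-apex vectors are reading directions) this is the frame side of `TailTypeSoundness₂` for module-ball
  readers of exact balls.
WHAT THIS IS NOT: not the dust analysis, not type soundness; F-C1 not moved.
-/

noncomputable section

namespace Summit.Ventures.Crystal3D.Theorems

namespace TailResidue

open Summit.Ventures.Crystal3D Finset NearIdentity
open scoped InnerProductSpace

variable {X : Finset (EuclideanSpace ℝ (Fin 3))} {G : EuclideanSpace ℝ (Fin 3) ≃ₗᵢ[ℝ] EuclideanSpace ℝ (Fin 3)}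
  {m d q b : EuclideanSpace ℝ (Fin 3)} {v : WordVersion}

/-! ### The upper cap of a menu plane is a slot triangle -/

/-- Table (kernel `decide`): for every cube vertex `c` there are three pairwise adjacent slots at positive `sdot3` with `c`. -/
theorem upper_cap_triangle_tab : ∀ c : Fin 8, ∃ l₁ l₂ l₃ : Fin 12,
    slotInt l₁ ⬝ᵥ slotInt l₂ = 1 ∧ slotInt l₁ ⬝ᵥ slotInt l₃ = 1 ∧ slotInt l₂ ⬝ᵥ slotInt l₃ = 1 ∧
      ¬ sdot3 (slotInt l₁) (cubeInt c) ≤ 0 ∧ ¬ sdot3 (slotInt l₂) (cubeInt c) ≤ 0 ∧ ¬ sdot3 (slotInt l₃) (cubeInt c) ≤ 0 := by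
  decide

/-- **The three slots above a menu plane form a slot triangle.** -/
theorem exists_upper_slot_triangle (hm : IsMenuNormal G m) :
    ∃ u₁ ∈ fccSlots, ∃ u₂ ∈ fccSlots, ∃ u₃ ∈ fccSlots, ⟪u₁, u₂⟫_ℝ = 1 / 2 ∧ ⟪u₁, u₃⟫_ℝ = 1 / 2 ∧ ⟪u₂, u₃⟫_ℝ = 1 / 2 ∧
      0 < ⟪G u₁, m⟫_ℝ ∧ 0 < ⟪G u₂, m⟫_ℝ ∧ 0 < ⟪G u₃, m⟫_ℝ := by
  obtain ⟨c, hc⟩ := exists_cubeInt_of_menu_normal G hm.1 hm.2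
  obtain ⟨l₁, l₂, l₃, h12, h13, h23, s1, s2, s3⟩ := upper_cap_triangle_tab c
  refine ⟨slotSite l₁, slotSite_mem l₁, slotSite l₂, slotSite_mem l₂, slotSite l₃, slotSite_mem l₃,
    inner_slotSite_eq_half_of_dot h12, inner_slotSite_eq_half_of_dot h13, inner_slotSite_eq_half_of_dot h23, ?_, ?_, ?_⟩
  · exact not_le.1 fun h => s1 ((twin_sgn_mem G hc l₁).1.1 h)
  · exact not_le.1 fun h => s2 ((twin_sgn_mem G hc l₂).1.1 h)
  · exact not_le.1 fun h => s3 ((twin_sgn_mem G hc l₃).1.1 h)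

/-! ### Contact triangles of readers -/

/-- A FULL reader has an occupied slot triangle. -/
theorem exists_contact_triangle_of_isFull (h : IsFull X G q) :
    ∃ u₁ ∈ fccSlots, ∃ u₂ ∈ fccSlots, ∃ u₃ ∈ fccSlots, ⟪u₁, u₂⟫_ℝ = 1 / 2 ∧ ⟪u₁, u₃⟫_ℝ = 1 / 2 ∧ ⟪u₂, u₃⟫_ℝ = 1 / 2 ∧
      q + G u₁ ∈ X ∧ q + G u₂ ∈ X ∧ q + G u₃ ∈ X := by
  obtain ⟨u₂, hu₂, u₃, hu₃, h12, h13, h23⟩ := exists_slot_triangle (slotSite_mem 0)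
  exact ⟨slotSite 0, slotSite_mem 0, u₂, hu₂, u₃, hu₃, h12, h13, h23, h _ (slotSite_mem 0), h _ hu₂, h _ hu₃⟩

/-- A TWIN reader has an occupied slot triangle (in its closed lower half-dozen). -/
theorem exists_contact_triangle_of_isTwinReading (h : IsTwinReading X G m q) :
    ∃ u₁ ∈ fccSlots, ∃ u₂ ∈ fccSlots, ∃ u₃ ∈ fccSlots, ⟪u₁, u₂⟫_ℝ = 1 / 2 ∧ ⟪u₁, u₃⟫_ℝ = 1 / 2 ∧ ⟪u₂, u₃⟫_ℝ = 1 / 2 ∧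
      q + G u₁ ∈ X ∧ q + G u₂ ∈ X ∧ q + G u₃ ∈ X := by
  -- a slot reading `≤ 0`: `slotSite 0` or its negative
  obtain ⟨w, hw, hle⟩ : ∃ w ∈ fccSlots, ⟪G w, m⟫_ℝ ≤ 0 := by
    by_cases h0 : ⟪G (slotSite 0), m⟫_ℝ ≤ 0
    · exact ⟨slotSite 0, slotSite_mem 0, h0⟩
    · refine ⟨-slotSite 0, neg_mem_fccSlots (slotSite_mem 0), ?_⟩
      rw [map_neg, inner_neg_left]
      linarith [not_le.1 h0]
  obtain ⟨u₂, hu₂, u₃, hu₃, h12, h13, h23, s2, s3⟩ := exists_lower_slot_triangle G h.1 hw hle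
  exact ⟨w, hw, u₂, hu₂, u₃, hu₃, h12, h13, h23, h.2.1 _ hw hle, h.2.1 _ hu₂ s2, h.2.1 _ hu₃ s3⟩

/-- A NARROW reader has an occupied slot triangle (the upper cap of its menu plane). -/
theorem exists_contact_triangle_of_isNarrow (h : IsNarrow X G d q) :
    ∃ u₁ ∈ fccSlots, ∃ u₂ ∈ fccSlots, ∃ u₃ ∈ fccSlots, ⟪u₁, u₂⟫_ℝ = 1 / 2 ∧ ⟪u₁, u₃⟫_ℝ = 1 / 2 ∧ ⟪u₂, u₃⟫_ℝ = 1 / 2 ∧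
      q + G u₁ ∈ X ∧ q + G u₂ ∈ X ∧ q + G u₃ ∈ X := by
  obtain ⟨-, m, hm, -, hocc⟩ := h
  obtain ⟨u₁, hu₁, u₂, hu₂, u₃, hu₃, h12, h13, h23, s1, s2, s3⟩ := exists_upper_slot_triangle hm
  exact ⟨u₁, hu₁, u₂, hu₂, u₃, hu₃, h12, h13, h23, hocc _ hu₁ s1, hocc _ hu₂ s2, hocc _ hu₃ s3⟩

/-- **The reader of an end move has an occupied slot triangle.** -/
theorem exists_contact_triangle_of_isEndMove (h : IsEndMove X v G d q b) :
    ∃ u₁ ∈ fccSlots, ∃ u₂ ∈ fccSlots, ∃ u₃ ∈ fccSlots, ⟪u₁, u₂⟫_ℝ = 1 / 2 ∧ ⟪u₁, u₃⟫_ℝ = 1 / 2 ∧ ⟪u₂, u₃⟫_ℝ = 1 / 2 ∧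
      q + G u₁ ∈ X ∧ q + G u₂ ∈ X ∧ q + G u₃ ∈ X := by
  rcases h with ⟨hread, -, -⟩ | ⟨m, htw, -, -, -⟩
  · rcases hread with hf | ⟨-, hn⟩ | ⟨m, htw, -⟩
    · exact exists_contact_triangle_of_isFull hf
    · exact exists_contact_triangle_of_isNarrow hn
    · exact exists_contact_triangle_of_isTwinReading htw
  · exact exists_contact_triangle_of_isTwinReading htw

/-! ### Standard frames of readers of reading directions -/

/-- **A reader all of whose contact directions are reading directions reads in a standard placement.**  (Module coordinates:
`X` is placed so that the module sites are `modSite s`; `readingDirs` of `…ReadingDirections`.) -/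
theorem stdFrame_of_contact_triangle {u₁ u₂ u₃ : EuclideanSpace ℝ (Fin 3)} (hu₁ : u₁ ∈ fccSlots) (hu₂ : u₂ ∈ fccSlots)
    (hu₃ : u₃ ∈ fccSlots) (h12 : ⟪u₁, u₂⟫_ℝ = 1 / 2) (h13 : ⟪u₁, u₃⟫_ℝ = 1 / 2) (h23 : ⟪u₂, u₃⟫_ℝ = 1 / 2)
    (r₁ : G u₁ ∈ readingDirs) (r₂ : G u₂ ∈ readingDirs) (r₃ : G u₃ ∈ readingDirs) : StdFrame G :=
  stdFrame_of_reading_triangle G ⟨u₁, Finset.mem_coe.2 hu₁, rfl⟩ ⟨u₂, Finset.mem_coe.2 hu₂, rfl⟩ ⟨u₃, Finset.mem_coe.2 hu₃, rfl⟩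
    (by rw [LinearIsometryEquiv.inner_map_map, h12]) (by rw [LinearIsometryEquiv.inner_map_map, h13])
    (by rw [LinearIsometryEquiv.inner_map_map, h23]) r₁ r₂ r₃

/-- **THE FRAME OF AN END MOVE WHOSE READER READS READING DIRECTIONS IS STANDARD.** -/
theorem stdFrame_of_isEndMove_of_readingDirs (h : IsEndMove X v G d q b)
    (hread : ∀ x ∈ X, dist x q = 1 → x - q ∈ readingDirs) : StdFrame G := by
  obtain ⟨u₁, hu₁, u₂, hu₂, u₃, hu₃, h12, h13, h23, o1, o2, o3⟩ := exists_contact_triangle_of_isEndMove h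
  have key : ∀ u ∈ fccSlots, q + G u ∈ X → G u ∈ readingDirs := by
    intro u hu hocc
    have := hread _ hocc (by rw [dist_eq_norm, add_sub_cancel_left, LinearIsometryEquiv.norm_map, norm_eq_one_of_mem_fccSlots hu])
    rwa [add_sub_cancel_left] at this
  exact stdFrame_of_contact_triangle hu₁ hu₂ hu₃ h12 h13 h23 (key _ hu₁ o1) (key _ hu₂ o2) (key _ hu₃ o3)

end TailResidue

end Summit.Ventures.Crystal3D.Theorems

end
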